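import Summits.RiemannHypothesis.RiemannHypothesis.Theorems.PfPersistenceAutocorrSplitEO
import Summits.RiemannHypothesis.RiemannHypothesis.Theorems.PfPersistenceAutocorrSplitMid
import Summits.RiemannHypothesis.RiemannHypothesis.Theorems.PfPersistenceParitySplitLaw
import HarnessLib

/-!
# PF-persistence cell — THE TWO-SIDED SHAPE PINCER at a reached prime (`eo` reader; RULING A272 (A3) made structural)

Framing (page 1): mechanism/rigidity campaign; no RH claims.  Every `theorem` below is PROVED (kernel-checked, RH-free,
weight-free: any `Weights` with `w(p) > 0`, any window); nothing asserts a premiss for `ζ` at any window.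

The EVEN down law (`PfPersistenceAutocorrSplitLaw` 06a91c08df81 / `…SplitEO` 119b16af3d09: a down-dial `K ≤ 1` at `p` with one
anti-correlated even test vector and `ℓ − ε₁⁺ < 2(1−K)w(p)(σ − 2φ(2N+1))` rejects the dialled datum) and the ODD up law
(`…SplitOdd` 119b16af3d09 far, `…SplitMid` 67f810576eaf near rungs: an up-dial `K ≥ 1` with one positively correlated odd test
vector and `ℓ′ − ε₁⁻ < 2(K−1)w(p)(τ − c)`, `c` = the total one-signed ceiling of the rung incl. the floor term) are the two jaws
of ONE statement: the set of dial values `K` at which the dialled datum is still in the `eo` reader `floorNodelessEOAt φ win`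
lies inside the closed interval `[1 − (ℓ − ε₁⁺)/(2w(p)(σ − 2φ(2N+1))), 1 + (ℓ′ − ε₁⁻)/(2w(p)(τ − c))]` — an OUTER bound
(sufficient conditions for rejection from infimum-type witnesses), never a guarantee of membership inside it.  §1 states it for a
generic odd ceiling `c` (hypothesis `hceil`); §2 instantiates the four typed rungs: far `log p ≥ a` (`c = 2φN`), `log p ≥ a/2`
(`1/2 + 2φN`), `log p ≥ a/3` (`√2/2 + 2φN`), `log p ≥ a/4` (`(1+√5)/4 + 2φN`).  The NUMBERS (test vectors, `ℓ, σ, ℓ′, τ` for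
`ζ` at a window) are DATA wherever asserted; nothing here asserts them.
-/

set_option linter.dupNamespace false

noncomputable section

namespace Summit.RiemannHypothesis.RiemannHypothesis.Theorems.PfPersistence

open Real Matrix BigOperators Finset

/-! ## §1 The pincer, generic in the odd ceiling -/

/-- **PROVED — THE TWO-SIDED SHAPE PINCER (generic odd ceiling `c`).**  At a window `win` reaching `p` with `w(p) > 0`,
`0 ≤ φ`: given (even jaw) `v ≠ 0` with `vᵀQ⁺(w)v ≤ ℓ‖v‖²`, `A_v(log p) ≤ −σ‖v‖²`, `σ > 2φ(2N+1)`, and (odd jaw) a ceiling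
`A⁻_u(log p) ≤ c‖u‖²` on every `φ`-floor-one-signed odd `u`, `v′ ≠ 0` with `v′ᵀQ⁻(w)v′ ≤ ℓ′‖v′‖²`, `τ‖v′‖² ≤ A⁻_{v′}(log p)`,
`τ > c`: every `K` with `datumOf (dial p K w) ∈ floorNodelessEOAt φ win` satisfies
`1 − (ℓ − ε₁(Q⁺(w)))/(2w(p)(σ − 2φ(2N+1))) ≤ K ≤ 1 + (ℓ′ − ε₁(Q⁻(w)))/(2w(p)(τ − c))`. [folklore] -/
theorem dial_mem_Icc_of_mem_floorNodelessEOAt_of_ceiling {win : Window} {p : ℕ} (hp : p ∈ primeRange (2 * win.a))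
    {w : Weights} (hw : 0 < w p) {φ : ℝ} (hφ : 0 ≤ φ) {c : ℝ}
    (hceil : ∀ u : Fin win.N → ℝ, FloorOneSignedOdd (2 * win.a) φ u →
      oddAutocorr (2 * win.a) u (Real.log p) ≤ c * (u ⬝ᵥ u))
    {v : Fin (win.N + 1) → ℝ} (hv : v ≠ 0) {ℓ σ : ℝ} (hℓ : v ⬝ᵥ (evenBlock w win *ᵥ v) ≤ ℓ * (v ⬝ᵥ v))
    (hσ : autocorr (2 * win.a) v (Real.log p) ≤ -σ * (v ⬝ᵥ v)) (hσ' : 2 * φ * (2 * win.N + 1) < σ)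
    {v' : Fin win.N → ℝ} (hv' : v' ≠ 0) {ℓ' τ : ℝ} (hℓ' : v' ⬝ᵥ (oddBlock w win *ᵥ v') ≤ ℓ' * (v' ⬝ᵥ v'))
    (hτ : τ * (v' ⬝ᵥ v') ≤ oddAutocorr (2 * win.a) v' (Real.log p)) (hτ' : c < τ) {K : ℝ}
    (hK : datumOf (dial p K w) ∈ floorNodelessEOAt φ win) :
    1 - (ℓ - bottomRayleigh (evenBlock w win)) / (2 * w p * (σ - 2 * φ * (2 * win.N + 1))) ≤ K ∧
      K ≤ 1 + (ℓ' - bottomRayleigh (oddBlock w win)) / (2 * w p * (τ - c)) := by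
  have hε : bottomRayleigh (evenBlock w win) ≤ ℓ := bottomRayleigh_le_of_testBound _ hv hℓ
  have hε' : bottomRayleigh (oddBlock w win) ≤ ℓ' := bottomRayleigh_le_of_testBound _ hv' hℓ'
  have hden : 0 < 2 * w p * (σ - 2 * φ * (2 * win.N + 1)) := by
    have : 0 < σ - 2 * φ * (2 * win.N + 1) := by linarith
    positivity
  have hden' : 0 < 2 * w p * (τ - c) := by
    have : 0 < τ - c := by linarith
    positivity
  constructor
  · by_contra hlt
    push Not at hlt
    have hA0 : 0 ≤ (ℓ - bottomRayleigh (evenBlock w win)) / (2 * w p * (σ - 2 * φ * (2 * win.N + 1))) :=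
      div_nonneg (by linarith) hden.le
    have hK1 : K ≤ 1 := by linarith
    have hlt' : (ℓ - bottomRayleigh (evenBlock w win)) / (2 * w p * (σ - 2 * φ * (2 * win.N + 1))) < 1 - K := by
      linarith
    have h2 := mul_lt_mul_of_pos_right hlt' hden
    rw [div_mul_cancel₀ _ (ne_of_gt hden)] at h2
    have ht : ℓ - bottomRayleigh (evenBlock w win) < 2 * (1 - K) * w p * (σ - 2 * φ * (2 * win.N + 1)) := by
      have e : (1 - K) * (2 * w p * (σ - 2 * φ * (2 * win.N + 1)))
          = 2 * (1 - K) * w p * (σ - 2 * φ * (2 * win.N + 1)) := by ring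
      rw [← e]; exact h2
    exact dial_not_mem_floorNodelessEOAt_of_threshold hp hK1 hw.le hφ hv hℓ hσ ht hK
  · by_contra hlt
    push Not at hlt
    have hB0 : 0 ≤ (ℓ' - bottomRayleigh (oddBlock w win)) / (2 * w p * (τ - c)) := div_nonneg (by linarith) hden'.le
    have hK1 : 1 ≤ K := by linarith
    have hlt' : (ℓ' - bottomRayleigh (oddBlock w win)) / (2 * w p * (τ - c)) < K - 1 := by linarith
    have h2 := mul_lt_mul_of_pos_right hlt' hden'
    rw [div_mul_cancel₀ _ (ne_of_gt hden')] at h2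
    have ht : ℓ' - bottomRayleigh (oddBlock w win) < 2 * (K - 1) * w p * (τ - c) := by
      have e : (K - 1) * (2 * w p * (τ - c)) = 2 * (K - 1) * w p * (τ - c) := by ring
      rw [← e]; exact h2
    have hdrop := upDial_levelDrop_of_threshold hp hK1 hw.le hv' hℓ' hτ ht
    exact upDial_not_mem_floorNodelessOddAt_of_ceiling hp hK1 hw.le hceil hdrop hK.2

/-! ## §2 The pincer on the four typed rungs -/

/-- **PROVED — FAR-PRIME PINCER (`a ≤ log p`, odd ceiling `2φN`).** [folklore] -/
theorem farDial_mem_Icc_of_mem_floorNodelessEOAt {win : Window} {p : ℕ} (hp : p ∈ primeRange (2 * win.a))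
    (hfar : win.a ≤ Real.log p) {w : Weights} (hw : 0 < w p) {φ : ℝ} (hφ : 0 ≤ φ)
    {v : Fin (win.N + 1) → ℝ} (hv : v ≠ 0) {ℓ σ : ℝ} (hℓ : v ⬝ᵥ (evenBlock w win *ᵥ v) ≤ ℓ * (v ⬝ᵥ v))
    (hσ : autocorr (2 * win.a) v (Real.log p) ≤ -σ * (v ⬝ᵥ v)) (hσ' : 2 * φ * (2 * win.N + 1) < σ)
    {v' : Fin win.N → ℝ} (hv' : v' ≠ 0) {ℓ' τ : ℝ} (hℓ' : v' ⬝ᵥ (oddBlock w win *ᵥ v') ≤ ℓ' * (v' ⬝ᵥ v'))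
    (hτ : τ * (v' ⬝ᵥ v') ≤ oddAutocorr (2 * win.a) v' (Real.log p)) (hτ' : 2 * φ * win.N < τ) {K : ℝ}
    (hK : datumOf (dial p K w) ∈ floorNodelessEOAt φ win) :
    1 - (ℓ - bottomRayleigh (evenBlock w win)) / (2 * w p * (σ - 2 * φ * (2 * win.N + 1))) ≤ K ∧
      K ≤ 1 + (ℓ' - bottomRayleigh (oddBlock w win)) / (2 * w p * (τ - 2 * φ * win.N)) := by
  have hL : 0 < 2 * win.a := by linarith [win.ha]
  exact dial_mem_Icc_of_mem_floorNodelessEOAt_of_ceiling hp hw hφ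
    (fun u hu => oddAutocorr_le_of_floorOneSignedOdd_far hL hφ hu (by linarith) (log_le_of_mem_primeRange hL.le hp))
    hv hℓ hσ hσ' hv' hℓ' hτ hτ' hK

/-- **PROVED — RUNG-2 PINCER (`a/2 ≤ log p`, odd ceiling `1/2 + 2φN`).** [folklore] -/
theorem midDial_mem_Icc_of_mem_floorNodelessEOAt {win : Window} {p : ℕ} (hp : p ∈ primeRange (2 * win.a))
    (hmid : win.a / 2 ≤ Real.log p) {w : Weights} (hw : 0 < w p) {φ : ℝ} (hφ : 0 ≤ φ)
    {v : Fin (win.N + 1) → ℝ} (hv : v ≠ 0) {ℓ σ : ℝ} (hℓ : v ⬝ᵥ (evenBlock w win *ᵥ v) ≤ ℓ * (v ⬝ᵥ v))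
    (hσ : autocorr (2 * win.a) v (Real.log p) ≤ -σ * (v ⬝ᵥ v)) (hσ' : 2 * φ * (2 * win.N + 1) < σ)
    {v' : Fin win.N → ℝ} (hv' : v' ≠ 0) {ℓ' τ : ℝ} (hℓ' : v' ⬝ᵥ (oddBlock w win *ᵥ v') ≤ ℓ' * (v' ⬝ᵥ v'))
    (hτ : τ * (v' ⬝ᵥ v') ≤ oddAutocorr (2 * win.a) v' (Real.log p)) (hτ' : 1 / 2 + 2 * φ * win.N < τ) {K : ℝ}
    (hK : datumOf (dial p K w) ∈ floorNodelessEOAt φ win) :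
    1 - (ℓ - bottomRayleigh (evenBlock w win)) / (2 * w p * (σ - 2 * φ * (2 * win.N + 1))) ≤ K ∧
      K ≤ 1 + (ℓ' - bottomRayleigh (oddBlock w win)) / (2 * w p * (τ - (1 / 2 + 2 * φ * win.N))) := by
  have hL : 0 < 2 * win.a := by linarith [win.ha]
  exact dial_mem_Icc_of_mem_floorNodelessEOAt_of_ceiling hp hw hφ
    (fun u hu => oddAutocorr_le_of_floorOneSignedOdd_mid hL hφ hu (by linarith) (log_le_of_mem_primeRange hL.le hp))
    hv hℓ hσ hσ' hv' hℓ' hτ hτ' hK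

/-- **PROVED — RUNG-3 PINCER (`a/3 ≤ log p`, odd ceiling `√2/2 + 2φN`).** [folklore] -/
theorem thirdDial_mem_Icc_of_mem_floorNodelessEOAt {win : Window} {p : ℕ} (hp : p ∈ primeRange (2 * win.a))
    (hthird : win.a / 3 ≤ Real.log p) {w : Weights} (hw : 0 < w p) {φ : ℝ} (hφ : 0 ≤ φ)
    {v : Fin (win.N + 1) → ℝ} (hv : v ≠ 0) {ℓ σ : ℝ} (hℓ : v ⬝ᵥ (evenBlock w win *ᵥ v) ≤ ℓ * (v ⬝ᵥ v))
    (hσ : autocorr (2 * win.a) v (Real.log p) ≤ -σ * (v ⬝ᵥ v)) (hσ' : 2 * φ * (2 * win.N + 1) < σ)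
    {v' : Fin win.N → ℝ} (hv' : v' ≠ 0) {ℓ' τ : ℝ} (hℓ' : v' ⬝ᵥ (oddBlock w win *ᵥ v') ≤ ℓ' * (v' ⬝ᵥ v'))
    (hτ : τ * (v' ⬝ᵥ v') ≤ oddAutocorr (2 * win.a) v' (Real.log p)) (hτ' : Real.sqrt 2 / 2 + 2 * φ * win.N < τ)
    {K : ℝ} (hK : datumOf (dial p K w) ∈ floorNodelessEOAt φ win) :
    1 - (ℓ - bottomRayleigh (evenBlock w win)) / (2 * w p * (σ - 2 * φ * (2 * win.N + 1))) ≤ K ∧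
      K ≤ 1 + (ℓ' - bottomRayleigh (oddBlock w win)) / (2 * w p * (τ - (Real.sqrt 2 / 2 + 2 * φ * win.N))) := by
  have hL : 0 < 2 * win.a := by linarith [win.ha]
  exact dial_mem_Icc_of_mem_floorNodelessEOAt_of_ceiling hp hw hφ
    (fun u hu => oddAutocorr_le_of_floorOneSignedOdd_third hL hφ hu (by linarith) (log_le_of_mem_primeRange hL.le hp))
    hv hℓ hσ hσ' hv' hℓ' hτ hτ' hK

/-- **PROVED — RUNG-4 PINCER (`a/4 ≤ log p`, odd ceiling `(1+√5)/4 + 2φN`)** — the rung every prime of every window with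
`a ≤ 4 log 2` sits on. [folklore] -/
theorem quarterDial_mem_Icc_of_mem_floorNodelessEOAt {win : Window} {p : ℕ} (hp : p ∈ primeRange (2 * win.a))
    (hq : win.a / 4 ≤ Real.log p) {w : Weights} (hw : 0 < w p) {φ : ℝ} (hφ : 0 ≤ φ)
    {v : Fin (win.N + 1) → ℝ} (hv : v ≠ 0) {ℓ σ : ℝ} (hℓ : v ⬝ᵥ (evenBlock w win *ᵥ v) ≤ ℓ * (v ⬝ᵥ v))
    (hσ : autocorr (2 * win.a) v (Real.log p) ≤ -σ * (v ⬝ᵥ v)) (hσ' : 2 * φ * (2 * win.N + 1) < σ)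
    {v' : Fin win.N → ℝ} (hv' : v' ≠ 0) {ℓ' τ : ℝ} (hℓ' : v' ⬝ᵥ (oddBlock w win *ᵥ v') ≤ ℓ' * (v' ⬝ᵥ v'))
    (hτ : τ * (v' ⬝ᵥ v') ≤ oddAutocorr (2 * win.a) v' (Real.log p))
    (hτ' : (1 + Real.sqrt 5) / 4 + 2 * φ * win.N < τ) {K : ℝ} (hK : datumOf (dial p K w) ∈ floorNodelessEOAt φ win) :
    1 - (ℓ - bottomRayleigh (evenBlock w win)) / (2 * w p * (σ - 2 * φ * (2 * win.N + 1))) ≤ K ∧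
      K ≤ 1 + (ℓ' - bottomRayleigh (oddBlock w win)) / (2 * w p * (τ - ((1 + Real.sqrt 5) / 4 + 2 * φ * win.N))) := by
  have hL : 0 < 2 * win.a := by linarith [win.ha]
  exact dial_mem_Icc_of_mem_floorNodelessEOAt_of_ceiling hp hw hφ
    (fun u hu => oddAutocorr_le_of_floorOneSignedOdd_quarter hL hφ hu (by linarith) (log_le_of_mem_primeRange hL.le hp))
    hv hℓ hσ hσ' hv' hℓ' hτ hτ' hK

/-- **PROVED — `ζ` handle of the rung-4 pincer** (`w = zetaWeights`, `0 < zetaWeights p` as a hypothesis — it holds at every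
prime power and is checked per instance; every other premiss is DATA wherever asserted). [folklore] -/
theorem zeta_quarterDial_mem_Icc_of_mem_floorNodelessEOAt {win : Window} {p : ℕ} (hp : p ∈ primeRange (2 * win.a))
    (hq : win.a / 4 ≤ Real.log p) (hw : 0 < zetaWeights p) {φ : ℝ} (hφ : 0 ≤ φ)
    {v : Fin (win.N + 1) → ℝ} (hv : v ≠ 0) {ℓ σ : ℝ} (hℓ : v ⬝ᵥ (evenBlock zetaWeights win *ᵥ v) ≤ ℓ * (v ⬝ᵥ v))
    (hσ : autocorr (2 * win.a) v (Real.log p) ≤ -σ * (v ⬝ᵥ v)) (hσ' : 2 * φ * (2 * win.N + 1) < σ)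
    {v' : Fin win.N → ℝ} (hv' : v' ≠ 0) {ℓ' τ : ℝ} (hℓ' : v' ⬝ᵥ (oddBlock zetaWeights win *ᵥ v') ≤ ℓ' * (v' ⬝ᵥ v'))
    (hτ : τ * (v' ⬝ᵥ v') ≤ oddAutocorr (2 * win.a) v' (Real.log p))
    (hτ' : (1 + Real.sqrt 5) / 4 + 2 * φ * win.N < τ) {K : ℝ}
    (hK : datumOf (dial p K zetaWeights) ∈ floorNodelessEOAt φ win) :
    1 - (ℓ - bottomRayleigh (evenBlock zetaWeights win)) / (2 * zetaWeights p * (σ - 2 * φ * (2 * win.N + 1))) ≤ K ∧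
      K ≤ 1 + (ℓ' - bottomRayleigh (oddBlock zetaWeights win))
        / (2 * zetaWeights p * (τ - ((1 + Real.sqrt 5) / 4 + 2 * φ * win.N))) :=
  quarterDial_mem_Icc_of_mem_floorNodelessEOAt hp hq hw hφ hv hℓ hσ hσ' hv' hℓ' hτ hτ' hK

end Summit.RiemannHypothesis.RiemannHypothesis.Theorems.PfPersistence

end
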